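import Summits.ResolutionOfSingularities.ResolutionOfSingularities.Theorems.FrobeniusLadderFInjectiveMacaulayficationNonFullLocusClosed
import Literature.AlgebraicGeometry.Resolution.CohenMacaulayLocusOpen
import HarnessLib

/-!
# `CMLocusOpen` from EGA IV₂ 6.11.3 BY NAME (crux `FInjectiveMacaulayfication` stmt-ResolutionOfSingularities-15315, chain w45a,
# hole #3γ / FC″; res-L1-w45a-plan-1 R16.5 (1); seat res-D-pv-019 AS res-L1-w45a-stub-7)

[OURS · L1 W4.5a] Support file (`--supports stmt-ResolutionOfSingularities-15315 --as helper`); NOT a statement of any manuscript;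
no definitions; AI-written (AI review is weaker than expert review). The input S-CMo `NonFullLocusClosed.CMLocusOpen` of the
FC′/FC″ surface rung (files F2/F3, `…S2ModificationHolds.fcForallExistsDimLe2_of_DM_CMLocusOpen`) is, token for token, the
Literature named fact `Literature.AlgebraicGeometry.Resolution.EGAIV2_cohenMacaulayLocusOpen` (EGA IV₂ Cor. 6.11.3 for `𝒪_X`,
schemes locally of finite type over a field) at universe `0`; this file records the one-line bridge, so that every `hCMo`
consumer of the chain is «modulo a printed theorem BY NAME» (FACT-LIST §B L-USE, to be booked by res-dag-4).
-/

-- single-problem summit: the doubled namespace component is forced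
set_option linter.dupNamespace false

noncomputable section

namespace Summit.ResolutionOfSingularities.ResolutionOfSingularities.Theorems.FInjectiveMacaulayfication.NonFullLocusClosed

/-- **S-CMo BY NAME**: `CMLocusOpen` is EGA IV₂ Cor. 6.11.3 (`𝓕 = 𝒪_X`, `X` locally of finite type over a field) —
`Literature.AlgebraicGeometry.Resolution.EGAIV2_cohenMacaulayLocusOpen` at universe `0`. [cite: EGAIV2, Cor. 6.11.3] -/
theorem cmLocusOpen_of_EGA (h : Literature.AlgebraicGeometry.Resolution.EGAIV2_cohenMacaulayLocusOpen.{0}) :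
    CMLocusOpen :=
  fun k _ X f hf => h k X f hf

/-- Conversely the typed input is exactly the named fact at universe `0` (sanity: no drift between the two texts).
[folklore] -/
theorem EGA_of_cmLocusOpen (h : CMLocusOpen) :
    Literature.AlgebraicGeometry.Resolution.EGAIV2_cohenMacaulayLocusOpen.{0} :=
  fun k _ X f hf => h k X f hf

end Summit.ResolutionOfSingularities.ResolutionOfSingularities.Theorems.FInjectiveMacaulayfication.NonFullLocusClosed

end
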